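import Summits.MatrixMultiplication.MatrixMultiplication.Theorems.TetraDiagonalLadder
import Summits.MatrixMultiplication.MatrixMultiplication.Theorems.TetrahedronTensorKronecker
import HarnessLib

/-!
# TetraDiagonalCover — Kronecker structure of the thin-diagonal tetrahedra and the cover
`ω_diag(ε) ≤ 4(1-ε) + ε·ω(K₄)`

(decomp-mm lens 6, generation 19; kernel A3 of NODE-g19, continuing `TetraDiagonalLadder`. Cut of record
UNCHANGED; theorems about the thin-diagonal family `Z_n^{(d)}` (`diagTetra`), no item.)

WHAT IS PROVED (every field; sorry-free, no new axiom / instance / notation / Prop-def):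
* §6 KRONECKER STRUCTURE `Z_{N·M}^{(M)}(i) = Z_N^{(1)}(K₁∘i) · T(K₄)_M(K₂∘i)` (`diagTetra_mul_apply`: at
  the product level the thin indicator sees only the first label component), sub-multiplicativity
  `R₄(Z_{N·M}^{(M)}) ≤ R₄(Z_N^{(1)}) · R₄(T(K₄)_M)`, the SQUARE COUNT `Z_N^{(1)} = Σ_{e ∈ [N]^4} ⊗_v b`
  (`diagTetra_one_eq_sum`; the padded 4-cycle `C₄`) with `R₄(Z_N^{(1)}) ≤ N⁴`, level monotonicity
  (`tensorRankD_diagTetra_level_mono`), and the finite cover `R₄(Z_n^{(M)}) ≤ (n/M+1)⁴ · R₄(T(K₄)_M)`.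
* §7 THE COVER IN EXPONENTS `ω_diag(ε) ≤ 4(1-ε) + ε·ω(K₄)` (`omegaDiag_le_cover`, `0 ≤ ε ≤ 1`): the chord
  through `(0, 4)` and `(1, ω(K₄))` — edge-wise `Z^ε = ε·K₄ ⊕ (1-ε)·C₄`; hence `ω_diag(0) = 4` (the square
  is flat, `omegaDiag_zero`), the LINEAR DEFECT BOUND `ω_diag(ε) - 4 ≤ ε·(ω(K₄) - 4)`
  (`omegaDiag_defect_le`), `ω_diag(ε) ≤ 4(1-ε) + 2εω`, and the sandwich
  `max(4, ω(2,ε,2)) ≤ ω_diag(ε) ≤ min(ω(K₄), 4(1-ε) + ε·ω(K₄))` (`omegaDiag_sandwich`).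
  Kernel B (`TetraDiagonalCostume`) uses §7 to show that the exact no-saving residual of every THINNED
  family (`ε < 1`) is a costume of `ω = 2`: among the diagonal deformations of the tetrahedron only the
  uniform one (item 33478) carries a genuine residual.
Sources: [corpus:paper-arxiv-1609.07476 Ex. 1.1.2, Prop. 1.1.16 (proof)] · tree `TetrahedronTensorKronecker`.
-/

noncomputable section

set_option linter.dupNamespace false

open scoped BigOperators
open Filter Asymptotics
open Literature.Computability.AlgebraicComplexity
open Summit.MatrixMultiplication.MatrixMultiplication.Theorems.TetrahedronTensor
open Summit.MatrixMultiplication.MatrixMultiplication.Theses.TetrahedronCarving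

namespace Summit.MatrixMultiplication.MatrixMultiplication.Theorems.TetraDiagonal

/-! ## §6 Kronecker structure `Z_{N·M}^{(M)} = Z_N^{(1)} ⊠ T(K₄)_M`, the square count, and the cover
`ω_diag(ε) ≤ 4(1-ε) + ε·ω(K₄)` -/

section Kronecker

variable {F : Type*} [Field F]

/-- At the product level `N·M` with diagonal size `M`, the thin indicator only sees the FIRST (`Fin N`)
component of the label: `label < M ⟺ ⌊label / M⌋ = 0`. -/
theorem thinInd_mul_level {N M : ℕ} (j : Fin 3) (x : Fin ((N * M) ^ 3)) :
    thinInd F (N * M) M j x = thinInd F N 1 j (K₁ x) := by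
  rcases Nat.eq_zero_or_pos M with rfl | hM
  · exact absurd x.2 (by simp)
  have key : ∀ y : Fin (N * M),
      ((y : ℕ) < M ↔ (((finProdFinEquiv.symm y).1 : Fin N) : ℕ) < 1) := by
    intro y
    rw [finProdFinEquiv_symm_apply, Fin.coe_divNat, Nat.lt_one_iff]
    constructor
    · exact Nat.div_eq_of_lt
    · intro h
      have h2 := Nat.mod_add_div (y : ℕ) M
      rw [h, mul_zero, add_zero] at h2
      rw [← h2]
      exact Nat.mod_lt _ hM
  unfold thinInd K₁
  simp only [Equiv.symm_apply_apply]
  exact if_congr (key _) rfl rfl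

/-- **Pointwise Kronecker factorisation** `Z_{N·M}^{(M)}(i) = Z_N^{(1)}(K₁ ∘ i) · T(K₄)_M(K₂ ∘ i)`:
the thin-diagonal tetrahedron at level `N·M` with diagonal `M` is the square-type tensor `Z_N^{(1)}`
(matching labels frozen) on the first label components times a full tetrahedron on the second.
[cite: ChristandlVranaZuiddam2016, §1.1 (graph tensors multiply under ⊠)] -/
theorem diagTetra_mul_apply {N M : ℕ} (i : Fin 4 → Fin ((N * M) ^ 3)) :
    diagTetra F (N * M) M i =
      diagTetra F N 1 (fun v => K₁ (i v)) * tetra F M (fun v => K₂ (i v)) := by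
  simp only [diagTetra, prod_thinLegs, thinInd_mul_level, tetra_mul_apply]
  ring

/-- **Kronecker sub-multiplicativity** `R₄(Z_{N·M}^{(M)}) ≤ R₄(Z_N^{(1)}) · R₄(T(K₄)_M)`.
[cite: ChristandlVranaZuiddam2016, Prop. 1.1.16 (proof)] -/
theorem tensorRankD_diagTetra_mul_le (N M : ℕ) :
    tensorRankD (diagTetra F (N * M) M) ≤
      tensorRankD (diagTetra F N 1) * tensorRankD (tetra F M) := by
  classical
  obtain ⟨u₁, hu₁⟩ := exists_rankOne_decomposition_diagTetra (F := F) N 1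
  obtain ⟨u₂, hu₂⟩ := exists_rankOne_decomposition_tetra (F := F) M
  set L : Fin (tensorRankD (diagTetra F N 1)) × Fin (tensorRankD (tetra F M)) →
      Fin 4 → Fin ((N * M) ^ 3) → F :=
    fun k v x => u₁ k.1 v (K₁ x) * u₂ k.2 v (K₂ x) with hL
  have hsum : ∑ k, rankOneTensor (L k) = diagTetra F (N * M) M := by
    funext i
    rw [Finset.sum_apply, Fintype.sum_prod_type, diagTetra_mul_apply,
      ← congrFun hu₁ (fun v => K₁ (i v)), ← congrFun hu₂ (fun v => K₂ (i v)),
      Finset.sum_apply, Finset.sum_apply, Finset.sum_mul_sum]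
    refine Finset.sum_congr rfl fun k₁ _ => Finset.sum_congr rfl fun k₂ _ => ?_
    simp only [rankOneTensor_apply, hL, ← Finset.prod_mul_distrib]
  have hcard : Fintype.card (Fin (tensorRankD (diagTetra F N 1)) × Fin (tensorRankD (tetra F M))) =
      tensorRankD (diagTetra F N 1) * tensorRankD (tetra F M) := by simp
  rw [← hcard]
  let e := Fintype.equivFin (Fin (tensorRankD (diagTetra F N 1)) × Fin (tensorRankD (tetra F M)))
  refine tensorRankD_le_of_eq_sum (fun k => L (e.symm k)) ?_
  rw [← hsum]
  exact Fintype.sum_equiv e.symm _ _ (fun _ => rfl)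

/-- **The square count**: `Z_N^{(1)}` (matching frozen) is the sum over the `N⁴` labellings of the
4-cycle of the rank-one tensors `⊗_v b_{labels at v}` — the 4-cycle graph tensor `T(C₄)_N` padded by
the frozen slots. (CVZ19 Ex. 1.1.2 for `C₄`). -/
theorem diagTetra_one_eq_sum (N : ℕ) [NeZero N] :
    diagTetra F N 1 = ∑ e : Fin 4 → Fin N, rankOneTensor (legVec F (cycExt e)) := by
  classical
  funext i
  rw [Finset.sum_apply]
  simp only [rankOneTensor_legVec_apply]
  set L : Fin 4 → Fin 3 → Fin N := fun v => finFunctionFinEquiv.symm (i v) with hLdef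
  have hx0 : thinInd F N 1 0 (i 0) = if L 0 0 = 0 then (1 : F) else 0 := by
    unfold thinInd
    refine if_congr ?_ rfl rfl
    rw [Nat.lt_one_iff]
    exact Fin.val_eq_zero_iff
  have hx2 : thinInd F N 1 2 (i 2) = if L 2 2 = 0 then (1 : F) else 0 := by
    unfold thinInd
    refine if_congr ?_ rfl rfl
    rw [Nat.lt_one_iff]
    exact Fin.val_eq_zero_iff
  have ht : tetra F N i = if consistent L = true then (1 : F) else 0 := rfl
  have hlhs : diagTetra F N 1 i =
      if (L 0 0 = 0 ∧ L 2 2 = 0) ∧ consistent L = true then (1 : F) else 0 := by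
    simp only [diagTetra, prod_thinLegs, hx0, hx2, ht, ite_zero_mul_ite_zero, mul_one]
  rw [hlhs]
  by_cases hc : (L 0 0 = 0 ∧ L 2 2 = 0) ∧ consistent L = true
  · obtain ⟨⟨h00, h22⟩, hL⟩ := hc
    rw [if_pos ⟨⟨h00, h22⟩, hL⟩, Finset.sum_eq_single (cycDec L)]
    · rw [if_pos (vertexLabels_cycExt_cycDec hL h00 h22)]
    · intro e _ hne
      rw [if_neg]
      intro he
      exact hne (by rw [← he, cycDec_vertexLabels_cycExt])
    · intro h
      exact absurd (Finset.mem_univ _) h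
  · rw [if_neg hc]
    symm
    refine Finset.sum_eq_zero (fun e _ => ?_)
    rw [if_neg]
    intro he
    apply hc
    refine ⟨⟨?_, ?_⟩, he ▸ consistent_vertexLabels _⟩
    · rw [← he]
      simp [vertexLabels, cycExt]
    · rw [← he]
      simp [vertexLabels, cycExt]

/-- **`R₄(Z_N^{(1)}) ≤ N⁴`**: the square (matching frozen) is flat at every level. [folklore] -/
theorem tensorRankD_diagTetra_one_le (N : ℕ) : tensorRankD (diagTetra F N 1) ≤ N ^ 4 := by
  classical
  rcases Nat.eq_zero_or_pos N with rfl | hN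
  · calc tensorRankD (diagTetra F 0 1) ≤ tensorRankD (tetra F 0) :=
          tensorRankD_diagTetra_le_tetra 0 1
      _ ≤ 0 ^ 6 := tensorRankD_tetra_le 0
      _ = 0 ^ 4 := by norm_num
  haveI : NeZero N := ⟨by omega⟩
  have hcard : Fintype.card (Fin 4 → Fin N) = N ^ 4 := by simp
  rw [← hcard]
  let e := Fintype.equivFin (Fin 4 → Fin N)
  refine tensorRankD_le_of_eq_sum (fun k => legVec F (cycExt (e.symm k))) ?_
  rw [diagTetra_one_eq_sum]
  exact Fintype.sum_equiv e.symm _ _ (fun _ => rfl)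

/-- **The cover at a product level**: `R₄(Z_{N·M}^{(M)}) ≤ N⁴ · R₄(T(K₄)_M)`. [folklore] -/
theorem tensorRankD_diagTetra_mul_le' (N M : ℕ) :
    tensorRankD (diagTetra F (N * M) M) ≤ N ^ 4 * tensorRankD (tetra F M) :=
  (tensorRankD_diagTetra_mul_le N M).trans
    (Nat.mul_le_mul_right _ (tensorRankD_diagTetra_one_le N))

/-- `Z_n^{(d)}` is the pullback of `Z_{n'}^{(d)}` along the label embedding `Fin n ↪ Fin n'` (`n ≤ n'`;
`Fin.castLE` preserves the numeric value of a label, hence thinness). [folklore] -/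
theorem diagTetra_eq_pullback {n n' d : ℕ} (h : n ≤ n') :
    diagTetra F n d = fun i : Fin 4 → Fin (n ^ 3) =>
      diagTetra F n' d
        (fun v => finFunctionFinEquiv (fun j => Fin.castLE h (finFunctionFinEquiv.symm (i v) j))) := by
  funext i
  have ht := congrFun (tetra_eq_pullback (F := F) h) i
  simp only [diagTetra, prod_thinLegs, ht, thinInd, Equiv.symm_apply_apply, Fin.val_castLE]

/-- **Monotone in the level**: `R₄(Z_n^{(d)}) ≤ R₄(Z_{n'}^{(d)})` for `n ≤ n'`. [folklore] -/
theorem tensorRankD_diagTetra_level_mono {n n' d : ℕ} (h : n ≤ n') :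
    tensorRankD (diagTetra F n d) ≤ tensorRankD (diagTetra F n' d) := by
  rw [diagTetra_eq_pullback (F := F) (d := d) h]
  exact tensorRankD_pullback_le (diagTetra F n' d)
    (fun _ x => finFunctionFinEquiv (fun j => Fin.castLE h (finFunctionFinEquiv.symm x j)))
    (diagTetra_decomposable n' d)

/-- **Finite-level cover bound**: `R₄(Z_n^{(M)}) ≤ (⌊n/M⌋ + 1)⁴ · R₄(T(K₄)_M)` (`M ≥ 1`): pad `n` up to
`(⌊n/M⌋+1)·M` and factor. [folklore] -/
theorem tensorRankD_diagTetra_le_cover {n M : ℕ} (hM : 0 < M) :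
    tensorRankD (diagTetra F n M) ≤ (n / M + 1) ^ 4 * tensorRankD (tetra F M) := by
  have hle : n ≤ (n / M + 1) * M := by
    rw [add_mul, one_mul]
    exact (Nat.lt_div_mul_add hM).le
  exact (tensorRankD_diagTetra_level_mono hle).trans (tensorRankD_diagTetra_mul_le' _ _)

end Kronecker

/-! ## §7 The cover in exponents: `ω_diag(ε) ≤ 4(1-ε) + ε·ω(K₄)`, the flat square `ω_diag(0) = 4`,
and the linear defect bound -/

section Cover

variable (F : Type) [Field F]

/-- **Cover, admissible-exponent form**: if `β` is admissible for `T(K₄)` then `4(1-ε) + εβ` is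
admissible for the `ε`-thin family (`0 ≤ ε ≤ 1`): `R₄(Z_n^{(⌈n^ε⌉)}) ≤ (n/⌈n^ε⌉ + 1)⁴ · R₄(T(K₄)_{⌈n^ε⌉})
≲ n^{4(1-ε)} · n^{εβ}`. [cite: ChristandlVranaZuiddam2016, Prop. 1.1.16 (proof)] -/
theorem mem_diagAdmissibleExponents_cover {ε β : ℝ} (hε0 : 0 ≤ ε) (hε1 : ε ≤ 1)
    (hβ : β ∈ tetraAdmissibleExponents F) :
    4 * (1 - ε) + ε * β ∈ diagAdmissibleExponents F ε := by
  have hβ4 : 4 ≤ β := four_le_of_mem_tetraAdmissibleExponents F hβ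
  have hβ0 : 0 ≤ β := by linarith
  obtain ⟨C, hC0, hC⟩ := bound_of_isBigO_nat_atTop hβ
  refine IsBigO.of_bound (16 * C * 2 ^ β) ?_
  filter_upwards [eventually_ge_atTop 1] with n hn
  have hn' : (1 : ℝ) ≤ n := by exact_mod_cast hn
  have hnpos : (0 : ℝ) < n := by linarith
  have hM1 : 1 ≤ rectDim n ε := one_le_rectDim hn ε
  have hMpos : (0 : ℝ) < (rectDim n ε : ℝ) := by exact_mod_cast hM1
  have hMle : (rectDim n ε : ℝ) ≤ 2 * (n : ℝ) ^ ε := by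
    have h := rectDim_le hn ε
    rwa [max_eq_left hε0] at h
  have hMge : (n : ℝ) ^ ε ≤ (rectDim n ε : ℝ) := Nat.le_ceil _
  have hfin := tensorRankD_diagTetra_le_cover (F := F) (n := n) hM1
  have htet : (tensorRankD (tetra F (rectDim n ε)) : ℝ) ≤ C * (rectDim n ε : ℝ) ^ β := by
    have hne : ((rectDim n ε : ℕ) : ℝ) ^ β ≠ 0 := (Real.rpow_pos_of_pos hMpos β).ne'
    have h := hC hne
    rwa [Real.norm_of_nonneg (Nat.cast_nonneg _),
      Real.norm_of_nonneg (Real.rpow_nonneg (Nat.cast_nonneg _) _)] at h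
  have hN : ((n / rectDim n ε + 1 : ℕ) : ℝ) ≤ 2 * (n : ℝ) ^ (1 - ε) := by
    have h1 : ((n / rectDim n ε : ℕ) : ℝ) ≤ (n : ℝ) / (rectDim n ε : ℝ) := Nat.cast_div_le
    have h2 : (n : ℝ) / (rectDim n ε : ℝ) ≤ (n : ℝ) ^ (1 - ε) := by
      rw [Real.rpow_sub hnpos, Real.rpow_one]
      exact div_le_div_of_nonneg_left hnpos.le (Real.rpow_pos_of_pos hnpos ε) hMge
    have h3 : (1 : ℝ) ≤ (n : ℝ) ^ (1 - ε) := Real.one_le_rpow hn' (by linarith)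
    push_cast
    linarith
  have hN0 : (0 : ℝ) ≤ ((n / rectDim n ε + 1 : ℕ) : ℝ) := Nat.cast_nonneg _
  have hMβ : (rectDim n ε : ℝ) ^ β ≤ (2 * (n : ℝ) ^ ε) ^ β :=
    Real.rpow_le_rpow hMpos.le hMle hβ0
  have hA : ((n : ℝ) ^ (1 - ε)) ^ (4 : ℕ) = (n : ℝ) ^ (4 * (1 - ε)) := by
    rw [← Real.rpow_natCast, ← Real.rpow_mul hnpos.le]
    congr 1
    push_cast
    ring
  have hB : ((n : ℝ) ^ ε) ^ β = (n : ℝ) ^ (ε * β) := by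
    rw [← Real.rpow_mul hnpos.le]
  have hAB : (n : ℝ) ^ (4 * (1 - ε)) * (n : ℝ) ^ (ε * β) = (n : ℝ) ^ (4 * (1 - ε) + ε * β) := by
    rw [← Real.rpow_add hnpos]
  rw [Real.norm_of_nonneg (Nat.cast_nonneg _),
    Real.norm_of_nonneg (Real.rpow_nonneg hnpos.le _)]
  calc (tensorRankD (diagTetra F n (rectDim n ε)) : ℝ)
      ≤ ((n / rectDim n ε + 1 : ℕ) : ℝ) ^ 4 * (tensorRankD (tetra F (rectDim n ε)) : ℝ) := by
        exact_mod_cast hfin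
    _ ≤ (2 * (n : ℝ) ^ (1 - ε)) ^ 4 * (C * (rectDim n ε : ℝ) ^ β) :=
        mul_le_mul (pow_le_pow_left₀ hN0 hN 4) htet (Nat.cast_nonneg _) (by positivity)
    _ ≤ (2 * (n : ℝ) ^ (1 - ε)) ^ 4 * (C * (2 * (n : ℝ) ^ ε) ^ β) :=
        mul_le_mul_of_nonneg_left (mul_le_mul_of_nonneg_left hMβ hC0.le) (by positivity)
    _ = 16 * C * 2 ^ β * (n : ℝ) ^ (4 * (1 - ε) + ε * β) := by
        rw [mul_pow, Real.mul_rpow (by norm_num : (0 : ℝ) ≤ 2) (Real.rpow_nonneg hnpos.le _), hA, hB,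
          ← hAB]
        norm_num
        ring

/-- **The cover** `ω_diag(ε) ≤ 4(1-ε) + ε·ω(K₄)` for `0 ≤ ε ≤ 1`: the thin-diagonal family is covered
through its tetrahedral summand `ε·K₄` plus the flat square `(1-ε)·C₄`. With the restriction bound
`ω_diag(ε) ≤ ω(K₄)` this is the chord below the graph of `ε ↦ ω_diag(ε)` through `(0,4)` and `(1,ω(K₄))`.
[cite: ChristandlVranaZuiddam2016, Prop. 1.1.16 (proof)] -/
theorem omegaDiag_le_cover {ε : ℝ} (hε0 : 0 ≤ ε) (hε1 : ε ≤ 1) :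
    omegaDiag F ε ≤ 4 * (1 - ε) + ε * omegaTetra F := by
  refine le_of_forall_pos_lt_add (fun δ hδ => ?_)
  have hδ' : 0 < δ / (ε + 1) := div_pos hδ (by linarith)
  have hβ : omegaTetra F + δ / (ε + 1) ∈ tetraAdmissibleExponents F :=
    mem_tetraAdmissibleExponents_of_lt F (by linarith)
  have hle : omegaDiag F ε ≤ 4 * (1 - ε) + ε * (omegaTetra F + δ / (ε + 1)) :=
    csInf_le (diagAdmissibleExponents_bddBelow F hε1) (mem_diagAdmissibleExponents_cover F hε0 hε1 hβ)
  have hq : ε / (ε + 1) < 1 := (div_lt_one (by linarith)).2 (by linarith)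
  have hεδ : ε * (δ / (ε + 1)) < δ := by
    have h := mul_lt_of_lt_one_right hδ hq
    calc ε * (δ / (ε + 1)) = δ * (ε / (ε + 1)) := by ring
      _ < δ := h
  rw [mul_add] at hle
  linarith

/-- **The square is flat**: `ω_diag(0) = 4` (diagonals of constant size: the padded 4-cycle `C₄`,
i.e. iterated matrix multiplication of length four). [folklore] -/
theorem omegaDiag_zero : omegaDiag F 0 = 4 := by
  refine le_antisymm ?_ (four_le_omegaDiag F zero_le_one)
  have h := omegaDiag_le_cover F le_rfl zero_le_one
  linarith

/-- **Linear defect bound**: `ω_diag(ε) - 4 ≤ ε·(ω(K₄) - 4)` — the flatness defect of the thin family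
is at most `ε` times the tetrahedron's defect (`0 ≤ ε ≤ 1`). [folklore] -/
theorem omegaDiag_defect_le {ε : ℝ} (hε0 : 0 ≤ ε) (hε1 : ε ≤ 1) :
    omegaDiag F ε - 4 ≤ ε * (omegaTetra F - 4) := by
  have h := omegaDiag_le_cover F hε0 hε1
  rw [mul_sub]
  linarith

/-- **Cover through `ω`**: `ω_diag(ε) ≤ 4(1-ε) + 2εω` (`0 ≤ ε ≤ 1`). [folklore] -/
theorem omegaDiag_le_cover_omega {ε : ℝ} (hε0 : 0 ≤ ε) (hε1 : ε ≤ 1) :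
    omegaDiag F ε ≤ 4 * (1 - ε) + 2 * ε * omega F := by
  have h := omegaDiag_le_cover F hε0 hε1
  have ht := mul_le_mul_of_nonneg_left (omegaTetra_le_two_mul_omega F) hε0
  linarith

/-- **The full sandwich** for `0 ≤ ε ≤ 1`:
`max(4, ω(2,ε,2)) ≤ ω_diag(ε) ≤ min(ω(K₄), 4(1-ε) + ε·ω(K₄))`. [folklore] -/
theorem omegaDiag_sandwich {ε : ℝ} (hε0 : 0 ≤ ε) (hε1 : ε ≤ 1) :
    omegaRect F 2 ε 2 ≤ omegaDiag F ε ∧ omegaDiag F ε ≤ omegaTetra F ∧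
      omegaDiag F ε ≤ 4 * (1 - ε) + ε * omegaTetra F :=
  ⟨omegaRect_two_mid_two_le_omegaDiag F hε1, omegaDiag_le_omegaTetra F hε1,
    omegaDiag_le_cover F hε0 hε1⟩

end Cover

end Summit.MatrixMultiplication.MatrixMultiplication.Theorems.TetraDiagonal

end
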